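import Mathlib.RingTheory.Polynomial.GaussLemma
import Mathlib.RingTheory.Polynomial.UniqueFactorization
import Mathlib.RingTheory.MvPolynomial.Homogeneous
import Mathlib.RingTheory.Localization.Integral
import Mathlib.FieldTheory.Separable
import Mathlib.FieldTheory.Perfect
import Mathlib.Algebra.MvPolynomial.Funext
import Mathlib.Algebra.MvPolynomial.Monad
import Mathlib.RingTheory.Polynomial.RationalRoot
import Mathlib.Algebra.CharP.Algebra
import Mathlib.Analysis.Complex.Basic
import Literature.FieldTheory.QuasiAlgClosed.Basic
import HarnessLib

/-!
# A line meeting an irreducible projective hypersurface transversally: the algebra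

Family `hodge`, layer `Literature/AlgebraicGeometry/HodgeTheory`. For the degree computation of a
smooth projective hypersurface `V₊(F) ⊂ ℙᴺ(ℂ)` (Voisin, *Hodge Theory and Complex Algebraic
Geometry II* (2003), §1.2.3 proof of Cor. 1.24–1.25 and Rem. 1.26: "a curve `C = X ∩ ℙ²` is of
degree `d`"; Griffiths–Harris, *Principles*, Ch. 1 §3, "the degree of a hypersurface is the number
of points of intersection with a generic line") one needs a line meeting the hypersurface
TRANSVERSALLY at every common point. This file supplies such a line by pure algebra, in normal
form: after an invertible linear change of homogeneous coordinates `A`, the form `G = F ∘ A` has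
`G(e₀) ≠ 0` (the point at infinity `[1:0:⋯:0]` of the coordinate line `{z₂ = ⋯ = z_{N} = 0}` is
off the hypersurface) and its restriction `g(t) = G(t, 1, 0, …, 0)` to that line has only SIMPLE
roots (all crossings are transversal):

* `linForms`, `linSubst A F` (`= F ∘ A` as a polynomial: `eval_linSubst`), `isHomogeneous_linSubst`,
  `linSubstEquiv` (an algebra automorphism for `A` invertible, so `irreducible_linSubst_iff`);
* `shearEquiv` — the invertible shears `z ↦ z + ℓ(z) • v`, `1 + ℓ(v) ≠ 0`, used as coordinate
  changes;
* **`exists_linSubst_transversal_line`** — for `F` homogeneous of degree `d ≥ 1` and IRREDUCIBLE in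
  `ℂ[z₀, …, z_{M+1}]`: there are `A` and `g ∈ ℂ[t]`, `g ≠ 0`, with `(F ∘ A)(e₀) ≠ 0`,
  `g(t) = (F ∘ A)(t, 1, 0, …, 0)` and `g(t) = 0 ⇒ g'(t) ≠ 0`.

Proof (Griffiths–Harris loc. cit. prove genericity by Bertini/Sard; here the elementary algebraic
argument): choose coordinates with `F(e₀) ≠ 0`; then `F`, read as a polynomial in `z₀` over
`R = ℂ[z₁, …, z_{M+1}]`, has unit leading coefficient, hence a monic associate, irreducible over
`Frac R` by **Gauss's lemma** (`Polynomial.Monic.irreducible_iff_irreducible_map_fraction_map`),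
hence **separable** there (characteristic `0`, `Irreducible.separable`); clearing denominators in a
Bézout identity `u F + v ∂₀F = 1` gives `U F + V ∂₀F = c'` with `0 ≠ c' ∈ R`, and at any
`u₀ ∈ ℂ^{M+1}` with `c'(u₀) ≠ 0` the specialisation `t ↦ F(t, u₀)` has only simple roots; a second
shear moves `(0, u₀)` to `e₁`. Everything here is proved; no named facts.

## References

* [VoisinHodgeII2003] C. Voisin, Hodge Theory and Complex Algebraic Geometry II, CUP 2003, §1.2.3
  Cor. 1.24–1.25, Rem. 1.26.
* [GriffithsHarrisPrinciples1978] P. Griffiths, J. Harris, Principles of Algebraic Geometry,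
  Wiley 1978, Ch. 1 §3 (degree of a variety; Bézout for a hypersurface and a line).
-/

noncomputable section

open MvPolynomial Polynomial Function

namespace Literature.AlgebraicGeometry.HodgeTheory

namespace TransversalLine

variable {k : ℕ}

/-! ### Linear substitutions `F ↦ F ∘ A` -/

/-- The linear forms `ℓ_j = ∑ᵢ a_{ji} Xᵢ` of a linear map `A`, `(A z)_j = ∑ᵢ a_{ji} zᵢ`. [folklore] -/
def linForms (A : (Fin k → ℂ) →ₗ[ℂ] (Fin k → ℂ)) (j : Fin k) : MvPolynomial (Fin k) ℂ :=
  ∑ i, MvPolynomial.C (A (Pi.single i 1) j) * MvPolynomial.X i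

/-- `ℓ_j(z) = (A z)_j`. [folklore] -/
theorem eval_linForms (A : (Fin k → ℂ) →ₗ[ℂ] (Fin k → ℂ)) (z : Fin k → ℂ) (j : Fin k) :
    MvPolynomial.eval z (linForms A j) = A z j := by
  simp only [linForms, map_sum, map_mul, MvPolynomial.eval_C, MvPolynomial.eval_X]
  conv_rhs => rw [LinearMap.pi_apply_eq_sum_univ A z]
  rw [Finset.sum_apply]
  refine Finset.sum_congr rfl fun i _ => ?_
  have : (fun j' : Fin k => if i = j' then (1 : ℂ) else 0) = Pi.single i 1 := by
    funext j'
    rw [Pi.single_apply]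
    by_cases h : i = j'
    · subst h; simp
    · rw [if_neg h, if_neg (Ne.symm h)]
  rw [this, Pi.smul_apply, smul_eq_mul, mul_comm]

/-- The linear forms are homogeneous of degree `1`. [folklore] -/
theorem isHomogeneous_linForms (A : (Fin k → ℂ) →ₗ[ℂ] (Fin k → ℂ)) (j : Fin k) :
    (linForms A j).IsHomogeneous 1 := by
  refine MvPolynomial.IsHomogeneous.sum _ _ _ fun i _ => ?_
  simpa using (MvPolynomial.isHomogeneous_C (Fin k) (A (Pi.single i 1) j)).mul
    (MvPolynomial.isHomogeneous_X ℂ i)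

/-- **The linear substitution `F ∘ A`** as a polynomial (`bind₁` of the linear forms of `A`).
[folklore] -/
def linSubst (A : (Fin k → ℂ) →ₗ[ℂ] (Fin k → ℂ)) (F : MvPolynomial (Fin k) ℂ) :
    MvPolynomial (Fin k) ℂ :=
  MvPolynomial.bind₁ (linForms A) F

/-- `(F ∘ A)(z) = F(A z)`. [folklore] -/
theorem eval_linSubst (A : (Fin k → ℂ) →ₗ[ℂ] (Fin k → ℂ)) (F : MvPolynomial (Fin k) ℂ)
    (z : Fin k → ℂ) : MvPolynomial.eval z (linSubst A F) = MvPolynomial.eval (A z) F := by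
  rw [linSubst]
  change MvPolynomial.eval₂Hom (RingHom.id ℂ) z (MvPolynomial.bind₁ (linForms A) F) = _
  rw [MvPolynomial.eval₂Hom_bind₁]
  change MvPolynomial.eval (fun i => MvPolynomial.eval z (linForms A i)) F = _
  have : (fun i => MvPolynomial.eval z (linForms A i)) = A z := funext fun j => eval_linForms A z j
  rw [this]

/-- `F ∘ A` is homogeneous of the same degree as `F`. [folklore] -/
theorem isHomogeneous_linSubst (A : (Fin k → ℂ) →ₗ[ℂ] (Fin k → ℂ)) {F : MvPolynomial (Fin k) ℂ}
    {d : ℕ} (hF : F.IsHomogeneous d) : (linSubst A F).IsHomogeneous d := by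
  have h := hF.aeval (linForms A) (isHomogeneous_linForms A)
  rw [one_mul] at h
  exact h

/-- Substituting along `A` and then along `B`: `(F ∘ A) ∘ B = F ∘ (A ∘ B)`. [folklore] -/
theorem linSubst_linSubst (A B : (Fin k → ℂ) →ₗ[ℂ] (Fin k → ℂ)) (F : MvPolynomial (Fin k) ℂ) :
    linSubst B (linSubst A F) = linSubst (A ∘ₗ B) F := by
  apply MvPolynomial.funext
  intro z
  rw [eval_linSubst, eval_linSubst, eval_linSubst, LinearMap.comp_apply]

/-- Substituting along the identity does nothing. [folklore] -/
theorem linSubst_id (F : MvPolynomial (Fin k) ℂ) : linSubst LinearMap.id F = F := by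
  apply MvPolynomial.funext
  intro z
  rw [eval_linSubst, LinearMap.id_apply]

/-- **Linear substitution along an invertible `A` is an algebra automorphism of
`ℂ[X₀, …, X_{k-1}]`** (inverse: substitution along `A⁻¹`). [folklore] -/
def linSubstEquiv (A : (Fin k → ℂ) ≃ₗ[ℂ] (Fin k → ℂ)) :
    MvPolynomial (Fin k) ℂ ≃ₐ[ℂ] MvPolynomial (Fin k) ℂ :=
  AlgEquiv.ofAlgHom (MvPolynomial.bind₁ (linForms (A : (Fin k → ℂ) →ₗ[ℂ] (Fin k → ℂ))))
    (MvPolynomial.bind₁ (linForms (A.symm : (Fin k → ℂ) →ₗ[ℂ] (Fin k → ℂ))))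
    (by
      apply AlgHom.ext
      intro F
      change linSubst (A : (Fin k → ℂ) →ₗ[ℂ] (Fin k → ℂ)) (linSubst _ F) = F
      rw [linSubst_linSubst]
      convert linSubst_id F
      ext z j
      simp)
    (by
      apply AlgHom.ext
      intro F
      change linSubst (A.symm : (Fin k → ℂ) →ₗ[ℂ] (Fin k → ℂ)) (linSubst _ F) = F
      rw [linSubst_linSubst]
      convert linSubst_id F
      ext z j
      simp)

/-- Unfolding `linSubstEquiv`. [folklore] -/
theorem linSubstEquiv_apply (A : (Fin k → ℂ) ≃ₗ[ℂ] (Fin k → ℂ)) (F : MvPolynomial (Fin k) ℂ) :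
    linSubstEquiv A F = linSubst (A : (Fin k → ℂ) →ₗ[ℂ] (Fin k → ℂ)) F := rfl

/-- Irreducibility is invariant under invertible linear substitutions. [folklore] -/
theorem irreducible_linSubst_iff (A : (Fin k → ℂ) ≃ₗ[ℂ] (Fin k → ℂ)) (F : MvPolynomial (Fin k) ℂ) :
    Irreducible (linSubst (A : (Fin k → ℂ) →ₗ[ℂ] (Fin k → ℂ)) F) ↔ Irreducible F := by
  rw [← linSubstEquiv_apply]
  exact MulEquiv.irreducible_iff (linSubstEquiv A)

/-! ### Shears -/

/-- **The shear `z ↦ z + ℓ(z) • v`**, an automorphism when `1 + ℓ(v) ≠ 0` (inverse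
`y ↦ y - (ℓ(y) / (1 + ℓ(v))) • v`). [folklore] -/
def shearEquiv {V : Type*} [AddCommGroup V] [Module ℂ V] (ℓ : V →ₗ[ℂ] ℂ) (v : V)
    (h : 1 + ℓ v ≠ 0) : V ≃ₗ[ℂ] V where
  toFun z := z + ℓ z • v
  invFun y := y - (ℓ y / (1 + ℓ v)) • v
  map_add' z z' := by rw [map_add, add_smul]; abel
  map_smul' c z := by rw [map_smul, smul_eq_mul, RingHom.id_apply, smul_add, smul_smul]
  left_inv z := by
    have : ℓ (z + ℓ z • v) / (1 + ℓ v) = ℓ z := by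
      rw [map_add, map_smul, smul_eq_mul, div_eq_iff h]; ring
    simp only [this]; abel
  right_inv y := by
    have : ℓ (y - (ℓ y / (1 + ℓ v)) • v) = ℓ y / (1 + ℓ v) := by
      rw [map_sub, map_smul, smul_eq_mul]
      field_simp
      ring
    simp only [this]
    rw [sub_add_cancel]

/-- Unfolding `shearEquiv`. [folklore] -/
@[simp]
theorem shearEquiv_apply {V : Type*} [AddCommGroup V] [Module ℂ V] (ℓ : V →ₗ[ℂ] ℂ) (v : V)
    (h : 1 + ℓ v ≠ 0) (z : V) : shearEquiv ℓ v h z = z + ℓ z • v := rfl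

/-! ### Homogeneous forms not vanishing at `e₀`, read as polynomials in `X₀` -/

/-- A homogeneous form of degree `d` evaluated at `e₀ = (1, 0, …, 0)` is its `X₀ᵈ`-coefficient.
[folklore] -/
theorem eval_single_zero_one_of_isHomogeneous {F : MvPolynomial (Fin (k + 1)) ℂ} {d : ℕ}
    (hF : F.IsHomogeneous d) :
    MvPolynomial.eval (Pi.single (0 : Fin (k + 1)) (1 : ℂ)) F =
      MvPolynomial.coeff (Finsupp.single 0 d) F := by
  classical
  rw [MvPolynomial.eval_eq]
  have key : ∀ m ∈ F.support, m ≠ Finsupp.single 0 d →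
      MvPolynomial.coeff m F * ∏ i ∈ m.support, (Pi.single (0 : Fin (k + 1)) (1 : ℂ)) i ^ m i = 0 := by
    intro m hm hne
    -- some variable other than `X₀` occurs in `m`
    obtain ⟨i, hi, hi0⟩ : ∃ i ∈ m.support, i ≠ 0 := by
      by_contra hcon
      push Not at hcon
      have hm0 : m = Finsupp.single 0 (m 0) := by
        ext i
        by_cases hi : i = 0
        · subst hi; simp
        · rw [Finsupp.single_eq_of_ne hi]
          by_contra hmi
          exact hi (hcon i (Finsupp.mem_support_iff.2 hmi))
      apply MvPolynomial.mem_support_iff.1 hm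
      apply hF.coeff_eq_zero
      rw [hm0, Finsupp.degree_single]
      intro h
      apply hne
      rw [hm0, h]
    apply mul_eq_zero_of_right
    apply Finset.prod_eq_zero hi
    rw [Pi.single_eq_of_ne hi0, zero_pow (Finsupp.mem_support_iff.1 hi)]
  rw [Finset.sum_eq_single (Finsupp.single 0 d) (fun m hm hne => key m hm hne) (fun hnot => by
    rw [MvPolynomial.notMem_support_iff.1 hnot, zero_mul])]
  by_cases hd : d = 0
  · subst hd; simp
  · rw [Finsupp.support_single _ hd, Finset.prod_singleton, Pi.single_eq_same, one_pow,
      mul_one]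

/-- For a homogeneous form `F` of degree `d` in `X₀, …, X_k`, read as a polynomial in `X₀` over
`ℂ[X₁, …, X_k]` (`finSuccEquiv`), the coefficient of `X₀ᵈ` is the constant `F(e₀)`. [folklore] -/
theorem coeff_finSuccEquiv_eq_C_of_isHomogeneous {F : MvPolynomial (Fin (k + 1)) ℂ} {d : ℕ}
    (hF : F.IsHomogeneous d) :
    (MvPolynomial.finSuccEquiv ℂ k F).coeff d =
      MvPolynomial.C (MvPolynomial.coeff (Finsupp.single 0 d) F) := by
  classical
  ext m
  rw [MvPolynomial.finSuccEquiv_coeff_coeff, MvPolynomial.coeff_C]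
  split_ifs with hm
  · subst hm
    congr 1
    ext i
    refine Fin.cases ?_ (fun j => ?_) i
    · rw [Finsupp.cons_zero, Finsupp.single_eq_same]
    · rw [Finsupp.cons_succ, Finsupp.single_eq_of_ne (Fin.succ_ne_zero j)]
      rfl
  · apply hF.coeff_eq_zero
    have hdeg : (m.cons d).degree = d + m.degree := by
      rw [Finsupp.degree_eq_sum, Finsupp.degree_eq_sum, Fin.sum_univ_succ, Finsupp.cons_zero]
      simp only [Finsupp.cons_succ]
    rw [hdeg]
    intro h
    apply hm
    have hm0 : m.degree = 0 := by omega
    exact ((Finsupp.degree_eq_zero_iff m).1 hm0).symm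

/-- Hence the polynomial in `X₀` has degree `≤ d`, and exactly `d` with leading coefficient the
constant `F(e₀)` when `F(e₀) ≠ 0`. [folklore] -/
theorem natDegree_finSuccEquiv_le_of_isHomogeneous {F : MvPolynomial (Fin (k + 1)) ℂ} {d : ℕ}
    (hF : F.IsHomogeneous d) : (MvPolynomial.finSuccEquiv ℂ k F).natDegree ≤ d := by
  rw [MvPolynomial.natDegree_finSuccEquiv]
  by_cases h0 : F = 0
  · subst h0; simp
  · exact (MvPolynomial.degreeOf_le_totalDegree F 0).trans (hF.totalDegree h0).le

/-! ### Polynomials separable over the fraction field: specialisations with simple roots -/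

section Separable

variable {R : Type*} [CommRing R]

/-- **Clearing denominators in a Bézout identity.** If `P ∈ R[X]` becomes separable over the
fraction field `K` of the domain `R`, there are `U, V ∈ R[X]` and `0 ≠ c ∈ R` with
`U P + V P' = c` (`IsLocalization.integerNormalization`). [folklore] -/
theorem exists_mul_add_mul_derivative_eq_C_of_separable_map [IsDomain R] (P : R[X])
    (hsep : (P.map (algebraMap R (FractionRing R))).Separable) :
    ∃ (U V : R[X]) (c : R), c ≠ 0 ∧ U * P + V * Polynomial.derivative P = Polynomial.C c := by
  obtain ⟨u, v, huv⟩ := (Polynomial.separable_def' _).1 hsep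
  obtain ⟨bu, hbu, hU⟩ := IsLocalization.integerNormalization_spec (nonZeroDivisors R) u
  obtain ⟨bv, hbv, hV⟩ := IsLocalization.integerNormalization_spec (nonZeroDivisors R) v
  set U := IsLocalization.integerNormalization (nonZeroDivisors R) u
  set V := IsLocalization.integerNormalization (nonZeroDivisors R) v
  refine ⟨Polynomial.C bv * U, Polynomial.C bu * V, bu * bv,
    mul_ne_zero (nonZeroDivisors.ne_zero hbu) (nonZeroDivisors.ne_zero hbv), ?_⟩
  apply Polynomial.map_injective (algebraMap R (FractionRing R))
    (IsFractionRing.injective R (FractionRing R))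
  simp only [Polynomial.map_add, Polynomial.map_mul, Polynomial.map_C, ← Polynomial.derivative_map,
    hU, hV, map_mul, Algebra.smul_def, Polynomial.algebraMap_apply]
  linear_combination (Polynomial.C (algebraMap R (FractionRing R) bu) *
    Polynomial.C (algebraMap R (FractionRing R) bv)) * huv

/-- **Specialisations with simple roots.** If `U P + V P' = c` in `R[X]` and `φ : R → S` is a ring
map with `φ c ≠ 0`, then every root of `P^φ` in `S` is simple: `P^φ(t) = 0 ⇒ (P^φ)'(t) ≠ 0`.
[folklore] -/
theorem eval_derivative_map_ne_zero_of_eval_eq_zero {S : Type*} [CommRing S] [IsDomain S]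
    {P U V : R[X]} {c : R} (h : U * P + V * Polynomial.derivative P = Polynomial.C c)
    (φ : R →+* S) (hc : φ c ≠ 0) {t : S} (ht : (P.map φ).eval t = 0) :
    (Polynomial.derivative (P.map φ)).eval t ≠ 0 := by
  intro hd
  have key := congrArg (fun Q : R[X] => (Q.map φ).eval t) h
  simp only [Polynomial.map_add, Polynomial.map_mul, Polynomial.eval_add, Polynomial.eval_mul,
    ← Polynomial.derivative_map, ht, hd, mul_zero, add_zero, Polynomial.map_C, Polynomial.eval_C]
    at key
  exact hc key.symm

end Separable

/-! ### Non-vanishing points of non-zero polynomials -/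

/-- A non-zero polynomial over `ℂ` does not vanish at some point where, moreover, a prescribed
coordinate is non-zero (apply `MvPolynomial.funext` to `P · Xᵢ ≠ 0`). [folklore] -/
theorem exists_eval_ne_zero_and_apply_ne_zero {σ : Type*} {P : MvPolynomial σ ℂ} (hP : P ≠ 0)
    (i : σ) : ∃ z : σ → ℂ, MvPolynomial.eval z P ≠ 0 ∧ z i ≠ 0 := by
  by_contra hcon
  push Not at hcon
  have h0 : P * MvPolynomial.X i = 0 := by
    apply MvPolynomial.funext
    intro z
    rw [map_mul, MvPolynomial.eval_X, map_zero]
    by_cases hz : MvPolynomial.eval z P = 0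
    · rw [hz, zero_mul]
    · rw [hcon z hz, mul_zero]
  exact (mul_ne_zero hP (MvPolynomial.X_ne_zero i)) h0

/-! ### The theorem -/

/-- **Normalising the point at infinity.** For a non-zero homogeneous form `F` of degree `d` there
is an invertible linear substitution `A₁` (a shear) with `(F ∘ A₁)(e₀) ≠ 0`. [folklore] -/
theorem exists_linSubst_eval_single_ne_zero {F : MvPolynomial (Fin (k + 1)) ℂ} {d : ℕ}
    (hF : F.IsHomogeneous d) (h0 : F ≠ 0) :
    ∃ A₁ : (Fin (k + 1) → ℂ) ≃ₗ[ℂ] (Fin (k + 1) → ℂ),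
      MvPolynomial.eval (Pi.single 0 1) (linSubst (A₁ : (Fin (k + 1) → ℂ) →ₗ[ℂ] (Fin (k + 1) → ℂ)) F) ≠ 0 := by
  -- a point with `F(z) ≠ 0` and `z₀ ≠ 0`, rescaled to `z₀ = 1`
  obtain ⟨z, hz, hz0⟩ := exists_eval_ne_zero_and_apply_ne_zero h0 (0 : Fin (k + 1))
  set w : Fin (k + 1) → ℂ := (z 0)⁻¹ • z with hw
  have hw0 : w 0 = 1 := by rw [hw, Pi.smul_apply, smul_eq_mul, inv_mul_cancel₀ hz0]
  have hFw : MvPolynomial.eval w F ≠ 0 := by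
    rw [hw, hF.eval_smul_eq]
    exact mul_ne_zero (pow_ne_zero _ (inv_ne_zero hz0)) hz
  -- the shear `y ↦ y + y₀ • (w - e₀)` sends `e₀` to `w`
  set v : Fin (k + 1) → ℂ := w - Pi.single 0 1 with hv
  have hv0 : (LinearMap.proj (R := ℂ) (φ := fun _ : Fin (k + 1) => ℂ) 0) v = 0 := by
    rw [LinearMap.coe_proj, Function.eval, hv, Pi.sub_apply, hw0, Pi.single_eq_same, sub_self]
  have h1 : (1 : ℂ) + (LinearMap.proj (R := ℂ) (φ := fun _ : Fin (k + 1) => ℂ) 0) v ≠ 0 := by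
    rw [hv0, add_zero]; exact one_ne_zero
  refine ⟨shearEquiv (LinearMap.proj 0) v h1, ?_⟩
  rw [eval_linSubst]
  change MvPolynomial.eval (shearEquiv (LinearMap.proj 0) v h1 (Pi.single 0 1)) F ≠ 0
  rw [shearEquiv_apply, LinearMap.coe_proj, Function.eval, Pi.single_eq_same, one_smul, hv,
    add_sub_cancel]
  exact hFw

/-- `(t, 1, 0, …, 0) + ((0, u) - e₁) = (t, u)` when read through `Fin.cons` (coordinates). [folklore] -/
theorem cons_single_add_sub {M : ℕ} (t : ℂ) (u : Fin (M + 1) → ℂ) :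
    (Fin.cons t (Pi.single (0 : Fin (M + 1)) (1 : ℂ)) : Fin (M + 2) → ℂ) +
        ((Fin.cons 0 u : Fin (M + 2) → ℂ) - Pi.single 1 1) = Fin.cons t u := by
  ext i
  refine Fin.cases ?_ (fun j => ?_) i
  · simp
  · simp only [Pi.add_apply, Pi.sub_apply, Fin.cons_succ]
    rw [← Fin.succ_zero_eq_one, Pi.single_apply, Pi.single_apply]
    simp only [Fin.succ_inj]
    split_ifs <;> ring

/-- **A transversal line, in normal form.** Let `F ∈ ℂ[X₀, …, X_{M+1}]` be homogeneous of degree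
`d ≥ 1` and irreducible. Then after an invertible linear substitution `A` the form `G = F ∘ A`
satisfies `G(e₀) ≠ 0`, and its restriction `g(t) = G(t, 1, 0, …, 0)` to the line through `e₀` and
`e₁` is a non-zero polynomial all of whose roots are simple (`g(t) = 0 ⇒ g'(t) ≠ 0`): the line
`{[s : t : 0 : ⋯ : 0]}` misses the hypersurface `V(G)` at its point `[1 : 0 : ⋯ : 0]` and meets it
transversally everywhere else (Griffiths–Harris, Ch. 1 §3: a generic line meets a hypersurface of
degree `d` transversally; here obtained algebraically from the irreducibility of `F` by Gauss's
lemma and separability in characteristic zero).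
[cite: GriffithsHarrisPrinciples1978, Ch. 1 §3] [cite: VoisinHodgeII2003, §1.2.3 Rem. 1.26] -/
theorem exists_linSubst_transversal_line {M d : ℕ} {F : MvPolynomial (Fin (M + 2)) ℂ}
    (hF : F.IsHomogeneous d) (hirr : Irreducible F) :
    ∃ (A : (Fin (M + 2) → ℂ) ≃ₗ[ℂ] (Fin (M + 2) → ℂ)) (g : ℂ[X]),
      MvPolynomial.eval (Pi.single 0 1)
          (linSubst (A : (Fin (M + 2) → ℂ) →ₗ[ℂ] (Fin (M + 2) → ℂ)) F) ≠ 0 ∧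
        g ≠ 0 ∧
        (∀ t : ℂ, g.eval t = MvPolynomial.eval (Fin.cons t (Pi.single 0 1))
          (linSubst (A : (Fin (M + 2) → ℂ) →ₗ[ℂ] (Fin (M + 2) → ℂ)) F)) ∧
        ∀ t : ℂ, g.eval t = 0 → (Polynomial.derivative g).eval t ≠ 0 := by
  classical
  -- Step 1: coordinates with `F(e₀) ≠ 0`
  obtain ⟨A₁, hA₁⟩ := exists_linSubst_eval_single_ne_zero hF hirr.ne_zero
  set F₁ := linSubst (A₁ : (Fin (M + 2) → ℂ) →ₗ[ℂ] (Fin (M + 2) → ℂ)) F with hF₁def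
  have hF₁ : F₁.IsHomogeneous d := isHomogeneous_linSubst _ hF
  have hirr₁ : Irreducible F₁ := (irreducible_linSubst_iff A₁ F).2 hirr
  set c₀ : ℂ := MvPolynomial.coeff (Finsupp.single 0 d) F₁ with hc₀def
  have hc₀ : c₀ ≠ 0 := by
    rw [hc₀def, ← eval_single_zero_one_of_isHomogeneous hF₁]; exact hA₁
  -- Step 2: `F₁` as a polynomial in `X₀` over `R = ℂ[X₁, …, X_{M+1}]`
  set R := MvPolynomial (Fin (M + 1)) ℂ with hRdef
  set P : R[X] := MvPolynomial.finSuccEquiv ℂ (M + 1) F₁ with hPdef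
  have hPd : P.coeff d = MvPolynomial.C c₀ := coeff_finSuccEquiv_eq_C_of_isHomogeneous hF₁
  have hCc₀ : (MvPolynomial.C c₀ : R) ≠ 0 := by
    rw [Ne, MvPolynomial.C_eq_zero]; exact hc₀
  have hPdeg : P.natDegree = d := Polynomial.natDegree_eq_of_le_of_coeff_ne_zero
    (natDegree_finSuccEquiv_le_of_isHomogeneous hF₁) (by rw [hPd]; exact hCc₀)
  have hPlead : P.leadingCoeff = MvPolynomial.C c₀ := by
    rw [Polynomial.leadingCoeff, hPdeg, hPd]
  have hirrP : Irreducible P :=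
    (MulEquiv.irreducible_iff (MvPolynomial.finSuccEquiv ℂ (M + 1)).toMulEquiv).2 hirr₁
  -- its monic associate is irreducible over `Frac R` (Gauss), hence separable there (char. 0)
  set P₁ : R[X] := Polynomial.C (MvPolynomial.C c₀⁻¹) * P with hP₁def
  have hmon : P₁.Monic := Polynomial.monic_C_mul_of_mul_leadingCoeff_eq_one (by
    rw [hPlead, ← map_mul, inv_mul_cancel₀ hc₀, map_one])
  have hunit : IsUnit (Polynomial.C (MvPolynomial.C c₀⁻¹) : R[X]) :=
    IsUnit.of_mul_eq_one (Polynomial.C (MvPolynomial.C c₀)) (by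
      rw [← map_mul, ← map_mul, inv_mul_cancel₀ hc₀, map_one, map_one])
  have hirrP₁ : Irreducible P₁ := (irreducible_isUnit_mul hunit).2 hirrP
  set K := FractionRing R with hKdef
  haveI : CharZero K := charZero_of_injective_algebraMap (IsFractionRing.injective R K)
  have hirrK : Irreducible (P₁.map (algebraMap R K)) :=
    hmon.irreducible_iff_irreducible_map_fraction_map.1 hirrP₁
  have hsep : (P₁.map (algebraMap R K)).Separable := hirrK.separable
  obtain ⟨U, V, c', hc', hUV⟩ := exists_mul_add_mul_derivative_eq_C_of_separable_map P₁ hsep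
  -- Step 3: specialise at `u₀` with `c'(u₀) ≠ 0` and `u₀ 0 ≠ 0`
  obtain ⟨u₀, hu₀c, hu₀0⟩ := exists_eval_ne_zero_and_apply_ne_zero hc' (0 : Fin (M + 1))
  set p : ℂ[X] := P.map (MvPolynomial.eval u₀) with hpdef
  have hp_eval : ∀ t, p.eval t = MvPolynomial.eval (Fin.cons t u₀) F₁ := fun t => by
    rw [hpdef, hPdef, MvPolynomial.eval_eq_eval_mv_eval']
  have hp0 : p ≠ 0 := by
    intro h
    apply hc₀
    have := congrArg (fun q : ℂ[X] => q.coeff d) h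
    simpa only [hpdef, Polynomial.coeff_map, hPd, MvPolynomial.eval_C, Polynomial.coeff_zero] using this
  have hp_simple : ∀ t, p.eval t = 0 → (Polynomial.derivative p).eval t ≠ 0 := by
    intro t ht hder
    have h1 : P₁.map (MvPolynomial.eval u₀) = Polynomial.C c₀⁻¹ * p := by
      rw [hP₁def, Polynomial.map_mul, Polynomial.map_C, MvPolynomial.eval_C]
    have h2 : (P₁.map (MvPolynomial.eval u₀)).eval t = 0 := by
      rw [h1, Polynomial.eval_mul, Polynomial.eval_C, ht, mul_zero]
    refine eval_derivative_map_ne_zero_of_eval_eq_zero hUV (MvPolynomial.eval u₀) hu₀c h2 ?_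
    rw [h1, Polynomial.derivative_mul, Polynomial.derivative_C, zero_mul, zero_add,
      Polynomial.eval_mul, Polynomial.eval_C, hder, mul_zero]
  -- Step 4: the shear `B`: `e₀ ↦ e₀`, `e₁ ↦ (0, u₀)`
  set v₂ : Fin (M + 2) → ℂ := (Fin.cons 0 u₀ : Fin (M + 2) → ℂ) - Pi.single 1 1 with hv₂
  have hℓ : ∀ z : Fin (M + 2) → ℂ,
      (LinearMap.proj (R := ℂ) (φ := fun _ : Fin (M + 2) => ℂ) 1) z = z 1 := fun z => rfl
  have hℓv : (LinearMap.proj (R := ℂ) (φ := fun _ : Fin (M + 2) => ℂ) 1) v₂ = u₀ 0 - 1 := by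
    rw [hℓ, hv₂, Pi.sub_apply, Pi.single_eq_same, ← Fin.succ_zero_eq_one, Fin.cons_succ]
  have h1B : (1 : ℂ) + (LinearMap.proj (R := ℂ) (φ := fun _ : Fin (M + 2) => ℂ) 1) v₂ ≠ 0 := by
    rw [hℓv, add_sub_cancel]; exact hu₀0
  set B := shearEquiv (LinearMap.proj 1) v₂ h1B with hBdef
  have hBe₀ : B (Pi.single 0 1) = Pi.single 0 1 := by
    rw [hBdef, shearEquiv_apply, hℓ, ← Fin.succ_zero_eq_one, Pi.single_eq_of_ne (Fin.succ_ne_zero 0),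
      zero_smul, add_zero]
  have hBline : ∀ t : ℂ, B (Fin.cons t (Pi.single 0 1)) = Fin.cons t u₀ := fun t => by
    rw [hBdef, shearEquiv_apply, hℓ, ← Fin.succ_zero_eq_one, Fin.cons_succ, Pi.single_eq_same,
      one_smul, hv₂]
    exact cons_single_add_sub t u₀
  -- assemble with `A = A₁ ∘ B`
  refine ⟨B.trans A₁, p, ?_, hp0, fun t => ?_, hp_simple⟩
  · rw [eval_linSubst, LinearEquiv.coe_coe, LinearEquiv.trans_apply, hBe₀]
    rw [eval_linSubst, LinearEquiv.coe_coe] at hA₁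
    exact hA₁
  · rw [hp_eval t, hF₁def, eval_linSubst, eval_linSubst, LinearEquiv.coe_coe, LinearEquiv.coe_coe,
      LinearEquiv.trans_apply, hBline t]


end TransversalLine

end Literature.AlgebraicGeometry.HodgeTheory

end
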